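import Summits.CriticalPhenomena.PercolationContinuityZ3.Theorems.PercNearOneGluingNoHeavyLowerTailMajorityGluingBudgetRowCore
import HarnessLib

/-!
# The vdBHK BUDGET ROWS of the abstract `(4,3)` programme as percolation theorems, part II: the inequality (lane prim-rate, constants-miner 1, gen 31; CANDIDATES §GEN-17 R135, §GEN-31)

Support file for the closed crux `NoHeavyLowerTail` (stmt-CriticalPhenomena-4575), majority-gluing line.  **THE BUDGET INEQUALITY**
(CANDIDATES §GEN-17 R135; the source of the linear vdBHK rows `Calone_x, Cnotfull_x, CaloneY_x_y, Cnotalone_x, …` of `HubOnly.TypeTable.SymLaw`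
and of step (2) of PROPOSITION W₀, hitherto a paper theorem): for Bernoulli bond percolation with arbitrary weights on the pairs of `Fin n`, a hub
`a`, two relays `s, t` with `μ(t ↮ a) ≤ μ(s ↮ a)` (e.g. `s` = the relay of largest cut probability) and ANY down-closed test `P` of the block
`B_s = clusOff {a} ω s` of `s` (its open cluster off the hub's pairs):
  **`μ(t ↮ a ∧ t ∉ B_s ∧ P(B_s)) ≤ μ(s ↮ a ∧ t ∉ B_s ∧ P(B_s))`** (`budget_row`).
Proof (R135): with the hub's pairs zeroed (`w₀`), `B_s` is the open cluster of `s`; given `B_s = W ∌ t`, `t` is cut with probability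
`ρ_t(W) = E[q(block of t off W̄)]` and `s` with probability `q(W)` (`q` = hub weight, part I); `F(W) = ρ_t(W) − q(W)` is INCREASING in `W`,
`G(W) = 1_P(W)` DECREASING, so van den Berg–Häggström–Kahn 2006 Thm 1.3 for the cluster of `s` given `{s ↮ t}`
(`BHK2006_clusterConditionalPositiveAssociation_holds.antitone_right`) gives `μ₀(D)·E[FG; D] ≤ E[F; D]·E[G; D]`, and `E[F; D] = μ(t ↮ a) − μ(s ↮ a) ≤ 0`
because blocks containing `t` cancel (`cut_iff_of_mem_block`).  The identifications are BHK's display (10) (`BHK2006.sum_cond_cluster`) and part I.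
No sorries, no definitions. [cite: VandenbergHaggstromKahn2005, Thm. 1.3 (p. 6)]
-/

noncomputable section

namespace Summit.CriticalPhenomena.PercolationContinuityZ3.Theorems

open MeasureTheory Set
open Literature.Probability.LatticeModels (prodBernoulli)
open Literature.Probability.Percolation
open Literature.Probability.Percolation.BHK2006
open DecisionTree (ind ind_of_mem ind_of_not_mem ind_nonneg)
open scoped Classical

namespace HubOnly
namespace Refresh
namespace Budget

variable {n : ℕ}

/-- **The identification** (BHK display (10) + conditioning on the off-hub configuration).  With the hub's pairs zeroed (`w₀`), for the
functional `F(W) = E_{w₀}[q(vx t C_t(η ∖ W̄))] − q(vx s W)` and any test `Q` of the vertex set of the cluster of `s`: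
`∫_{s ↮ t} 1_Q(C_s)·F(C_s) dμ₀ = μ(t ↮ a ∧ Q(B_s) ∧ t ∉ B_s) − μ(s ↮ a ∧ Q(B_s) ∧ t ∉ B_s)`. [cite: VandenbergHaggstromKahn2005, §1 pp. 7–8 (display (10))] -/
theorem setIntegral_indF_eq (w w₀ : Sym2 (Fin n) → unitInterval) (a s t : Fin n) (hsa : s ≠ a) (hta : t ≠ a)
    (h0 : ∀ e ∈ (↑(pairsAt {a}) : Set (Sym2 (Fin n))), w₀ e = 0) (h1 : ∀ e ∉ (↑(pairsAt {a}) : Set (Sym2 (Fin n))), w₀ e = w e)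
    (F : Set (Sym2 (Fin n)) → ℝ)
    (hF : ∀ W, F W = (∑ η, weight (fun e => (w₀ e : ℝ)) η *
      (1 - attachProb w {a} (vx t (openEdgeCluster (η \ {e | ∃ v ∈ e, v = s ∨ ∃ e' ∈ W, v ∈ e'}) t)))) -
      (1 - attachProb w {a} (vx s W)))
    (Q : Finset (Fin n) → Prop) :
    ∫ ω in {ω : BondConfig (Fin n) | ∀ x ∈ ({t} : Set (Fin n)), ¬ (openGraph ω).Reachable s x},
        ind {W : Set (Sym2 (Fin n)) | Q (vx s W)} (openEdgeCluster ω s) * F (openEdgeCluster ω s) ∂(prodBernoulli w₀) =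
      (prodBernoulli w).real {ω : BondConfig (Fin n) | ¬ (openGraph ω).Reachable a t ∧
          (Q (clusOff {a} ω s) ∧ t ∉ clusOff {a} ω s)} -
        (prodBernoulli w).real {ω : BondConfig (Fin n) | ¬ (openGraph ω).Reachable a s ∧
          (Q (clusOff {a} ω s) ∧ t ∉ clusOff {a} ω s)} := by
  set D : Set (BondConfig (Fin n)) := {ω | ∀ x ∈ ({t} : Set (Fin n)), ¬ (openGraph ω).Reachable s x} with hD
  have hDst : ∀ ω, ω ∈ D ↔ ¬ (openGraph ω).Reachable s t := fun ω => by simp [hD]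
  set h : Set (Sym2 (Fin n)) → ℝ := fun W => ind {W : Set (Sym2 (Fin n)) | Q (vx s W)} W with hh
  have hm₀ : ∑ ω, weight (fun e => (w₀ e : ℝ)) ω = 1 := by
    have h1 := integral_prodBernoulli_eq_sum w₀ fun _ => (1 : ℝ)
    simp only [integral_const, probReal_univ, smul_eq_mul, mul_one] at h1
    exact h1.symm
  -- as a finite sum, split along `F = condAvg − q`
  rw [CoreAttractionSep.setIntegral_eq_sum_ind]
  have hsplit : ∀ ω : BondConfig (Fin n), weight (fun e => (w₀ e : ℝ)) ω *
      (h (openEdgeCluster ω s) * F (openEdgeCluster ω s) * ind D ω) =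
      weight (fun e => (w₀ e : ℝ)) ω * ((∑ η, weight (fun e => (w₀ e : ℝ)) η *
        (h (openEdgeCluster ω s) * (1 - attachProb w {a}
          (vx t (openEdgeCluster (η \ {e | ∃ v ∈ e, v = s ∨ ∃ e' ∈ openEdgeCluster ω s, v ∈ e'}) t))))) * ind D ω) -
      weight (fun e => (w₀ e : ℝ)) ω * (h (openEdgeCluster ω s) * (1 - attachProb w {a} (vx s (openEdgeCluster ω s))) * ind D ω) := by
    intro ω
    have e1 : (∑ η, weight (fun e => (w₀ e : ℝ)) η * (h (openEdgeCluster ω s) * (1 - attachProb w {a}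
          (vx t (openEdgeCluster (η \ {e | ∃ v ∈ e, v = s ∨ ∃ e' ∈ openEdgeCluster ω s, v ∈ e'}) t))))) =
        h (openEdgeCluster ω s) * ∑ η, weight (fun e => (w₀ e : ℝ)) η * (1 - attachProb w {a}
          (vx t (openEdgeCluster (η \ {e | ∃ v ∈ e, v = s ∨ ∃ e' ∈ openEdgeCluster ω s, v ∈ e'}) t))) := by
      rw [Finset.mul_sum]
      exact Finset.sum_congr rfl fun η _ => by ring
    rw [hF, e1]
    ring
  rw [Finset.sum_congr rfl fun ω _ => hsplit ω, Finset.sum_sub_distrib]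
  -- BHK display (10): the conditional average is the plain product on `D`
  rw [← sum_cond_cluster (fun e => (w₀ e : ℝ)) hm₀ s t
    (fun W C => h W * (1 - attachProb w {a} (vx t C))) hDst]
  -- transfer both sums to the original weights, as functions of the off-hub configuration
  rw [← sum_offCfg_eq_sum_offWeights w w₀ a h0 h1
      (fun ω => h (openEdgeCluster ω s) * (1 - attachProb w {a} (vx t (openEdgeCluster ω t))) * ind D ω),
    ← sum_offCfg_eq_sum_offWeights w w₀ a h0 h1
      (fun ω => h (openEdgeCluster ω s) * (1 - attachProb w {a} (vx s (openEdgeCluster ω s))) * ind D ω)]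
  -- identify the integrands with those of part I
  have hident : ∀ (ω : BondConfig (Fin n)) (v : Fin n),
      h (openEdgeCluster (offCfg {a} ω) s) * (1 - attachProb w {a} (vx v (openEdgeCluster (offCfg {a} ω) v))) *
        ind D (offCfg {a} ω) =
      ind {ω : BondConfig (Fin n) | (fun ρ : BondConfig (Fin n) => Q (clus ρ s) ∧ t ∉ clus ρ s) (offCfg {a} ω)} ω *
        (1 - attachProb w {a} (clusOff {a} ω v)) := by
    intro ω v
    have hv : vx v (openEdgeCluster (offCfg {a} ω) v) = clusOff {a} ω v := by rw [vx_openEdgeCluster]; rfl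
    rw [hv]
    by_cases hQ : Q (clus (offCfg {a} ω) s)
    · by_cases hts : t ∈ clus (offCfg {a} ω) s
      · have hnD : offCfg {a} ω ∉ D := fun hd => (hDst _).1 hd (mem_clus.1 hts)
        rw [ind_of_not_mem hnD, ind_of_not_mem (show ω ∉ {ω : BondConfig (Fin n) |
          (fun ρ : BondConfig (Fin n) => Q (clus ρ s) ∧ t ∉ clus ρ s) (offCfg {a} ω)} from fun h' => h'.2 hts)]
        ring
      · have hd : offCfg {a} ω ∈ D := (hDst _).2 (fun hr => hts (mem_clus.2 hr))
        have hW : openEdgeCluster (offCfg {a} ω) s ∈ {W : Set (Sym2 (Fin n)) | Q (vx s W)} := by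
          show Q (vx s (openEdgeCluster (offCfg {a} ω) s)); rw [vx_openEdgeCluster]; exact hQ
        simp only [hh]
        rw [ind_of_mem hd, ind_of_mem hW, ind_of_mem (show ω ∈ {ω : BondConfig (Fin n) |
          (fun ρ : BondConfig (Fin n) => Q (clus ρ s) ∧ t ∉ clus ρ s) (offCfg {a} ω)} from ⟨hQ, hts⟩)]
        ring
    · have hW : openEdgeCluster (offCfg {a} ω) s ∉ {W : Set (Sym2 (Fin n)) | Q (vx s W)} := by
        show ¬ Q (vx s (openEdgeCluster (offCfg {a} ω) s)); rw [vx_openEdgeCluster]; exact hQ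
      simp only [hh]
      rw [ind_of_not_mem hW, ind_of_not_mem (show ω ∉ {ω : BondConfig (Fin n) |
        (fun ρ : BondConfig (Fin n) => Q (clus ρ s) ∧ t ∉ clus ρ s) (offCfg {a} ω)} from fun h' => hQ h'.1)]
      ring
  have hct := real_cut_and_offCfg w a t hta (fun ρ : BondConfig (Fin n) => Q (clus ρ s) ∧ t ∉ clus ρ s)
  have hcs := real_cut_and_offCfg w a s hsa (fun ρ : BondConfig (Fin n) => Q (clus ρ s) ∧ t ∉ clus ρ s)
  simp only [hident]
  rw [← hct, ← hcs]
  rfl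

/-- **THE BUDGET INEQUALITY (CANDIDATES §GEN-17 R135).**  For every finite weighted graph, hub `a`, relays `s ≠ t` (both `≠ a`) with
`μ(t ↮ a) ≤ μ(s ↮ a)`, and every DOWN-closed test `P` of the block `B_s = clusOff {a} ω s`:
`μ(t ↮ a ∧ t ∉ B_s ∧ P(B_s)) ≤ μ(s ↮ a ∧ t ∉ B_s ∧ P(B_s))`.  Instances: `P = «avoids the other relays»` (row `Calone_t`), `P = ⊤`, `P = «⊆ S»`, …
[cite: VandenbergHaggstromKahn2005, Thm. 1.3 (p. 6)] -/
theorem budget_row (w : Sym2 (Fin n) → unitInterval) (a s t : Fin n) (hsa : s ≠ a) (hta : t ≠ a) (hst : s ≠ t)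
    (P : Finset (Fin n) → Prop) (hP : ∀ S S' : Finset (Fin n), S ⊆ S' → P S' → P S)
    (hδ : (prodBernoulli w).real {ω : BondConfig (Fin n) | ¬ (openGraph ω).Reachable a t} ≤
      (prodBernoulli w).real {ω : BondConfig (Fin n) | ¬ (openGraph ω).Reachable a s}) :
    (prodBernoulli w).real {ω : BondConfig (Fin n) | ¬ (openGraph ω).Reachable a t ∧
        (P (clusOff {a} ω s) ∧ t ∉ clusOff {a} ω s)} ≤
      (prodBernoulli w).real {ω : BondConfig (Fin n) | ¬ (openGraph ω).Reachable a s ∧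
        (P (clusOff {a} ω s) ∧ t ∉ clusOff {a} ω s)} := by
  set μ := prodBernoulli w with hμ
  set A : Set (Sym2 (Fin n)) := ↑(pairsAt {a}) with hA
  set w₀ : Sym2 (Fin n) → unitInterval := fun e => if e ∈ A then 0 else w e with hw₀
  have h0 : ∀ e ∈ A, w₀ e = 0 := fun e he => by simp only [hw₀, if_pos he]
  have h1 : ∀ e ∉ A, w₀ e = w e := fun e he => by simp only [hw₀, if_neg he]
  have hw00 : ∀ e, 0 ≤ (fun e => (w₀ e : ℝ)) e := fun e => (w₀ e).2.1
  have hw01 : ∀ e, (fun e => (w₀ e : ℝ)) e ≤ 1 := fun e => (w₀ e).2.2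
  set q : Finset (Fin n) → ℝ := fun S => 1 - attachProb w {a} S with hq
  have hqa : Antitone q := hubWt_antitone w a
  set F : Set (Sym2 (Fin n)) → ℝ := fun W => (∑ η, weight (fun e => (w₀ e : ℝ)) η *
      q (vx t (openEdgeCluster (η \ {e | ∃ v ∈ e, v = s ∨ ∃ e' ∈ W, v ∈ e'}) t))) - q (vx s W) with hFdef
  set G : Set (Sym2 (Fin n)) → ℝ := fun W => ind {W : Set (Sym2 (Fin n)) | P (vx s W)} W with hGdef
  -- monotonicity
  have hFm : Monotone F := by
    have h1m : Monotone fun W : Set (Sym2 (Fin n)) => ∑ η, weight (fun e => (w₀ e : ℝ)) η *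
        q (vx t (openEdgeCluster (η \ {e | ∃ v ∈ e, v = s ∨ ∃ e' ∈ W, v ∈ e'}) t)) :=
      condAvg_mono hw00 hw01 t (bar_mono s) (H := fun (_ : Set (Sym2 (Fin n))) C => q (vx t C))
        (fun _ => fun _ _ _ => le_rfl) (fun _ => fun C C' hCC' => hqa (vx_mono t hCC'))
    intro W W' hWW'
    have := h1m hWW'
    have h2 : q (vx s W') ≤ q (vx s W) := hqa (vx_mono s hWW')
    simp only [hFdef]
    linarith
  have hGa : Antitone G := by
    intro W W' hWW'
    simp only [hGdef]
    by_cases hW' : W' ∈ {W : Set (Sym2 (Fin n)) | P (vx s W)}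
    · rw [ind_of_mem hW', ind_of_mem (show W ∈ {W : Set (Sym2 (Fin n)) | P (vx s W)} from hP _ _ (vx_mono s hWW') hW')]
    · rw [ind_of_not_mem hW']; exact ind_nonneg _ _
  -- van den Berg–Häggström–Kahn
  have hsX : s ∉ ({t} : Set (Fin n)) := by simpa using hst
  have key := BHK2006_clusterConditionalPositiveAssociation_holds.antitone_right (Fin n) w₀ s ({t} : Set (Fin n)) F G hFm hGa hsX
  set D : Set (BondConfig (Fin n)) := {ω | ∀ x ∈ ({t} : Set (Fin n)), ¬ (openGraph ω).Reachable s x} with hD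
  -- the three integrals
  have eFG : ∫ ω in D, F (openEdgeCluster ω s) * G (openEdgeCluster ω s) ∂(prodBernoulli w₀) =
      μ.real {ω | ¬ (openGraph ω).Reachable a t ∧ (P (clusOff {a} ω s) ∧ t ∉ clusOff {a} ω s)} -
        μ.real {ω | ¬ (openGraph ω).Reachable a s ∧ (P (clusOff {a} ω s) ∧ t ∉ clusOff {a} ω s)} := by
    rw [← setIntegral_indF_eq w w₀ a s t hsa hta h0 h1 F (fun W => rfl) P]
    exact integral_congr_ae (Filter.Eventually.of_forall fun ω => mul_comm _ _)
  have eF : ∫ ω in D, F (openEdgeCluster ω s) ∂(prodBernoulli w₀) =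
      μ.real {ω | ¬ (openGraph ω).Reachable a t ∧ (True ∧ t ∉ clusOff {a} ω s)} -
        μ.real {ω | ¬ (openGraph ω).Reachable a s ∧ (True ∧ t ∉ clusOff {a} ω s)} := by
    rw [← setIntegral_indF_eq w w₀ a s t hsa hta h0 h1 F (fun W => rfl) (fun _ => True)]
    refine integral_congr_ae (Filter.Eventually.of_forall fun ω => ?_)
    show F (openEdgeCluster ω s) = ind {W : Set (Sym2 (Fin n)) | True} (openEdgeCluster ω s) * F (openEdgeCluster ω s)
    rw [ind_of_mem (show openEdgeCluster ω s ∈ {W : Set (Sym2 (Fin n)) | True} from trivial), one_mul]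
  -- `E[F; D] = μ(t ↮ a) − μ(s ↮ a) ≤ 0`: blocks containing `t` cancel
  have hsplit : ∀ v : Fin n, (v = s ∨ v = t) → μ.real {ω | ¬ (openGraph ω).Reachable a v} =
      μ.real {ω | ¬ (openGraph ω).Reachable a v ∧ (True ∧ t ∉ clusOff {a} ω s)} +
        μ.real {ω | ¬ (openGraph ω).Reachable a s ∧ t ∈ clusOff {a} ω s} := by
    intro v hv
    rw [← measureReal_union (Set.disjoint_left.2 fun ω h1' h2' => h1'.2.2 h2'.2) MeasurableSet.of_discrete]
    congr 1
    ext ω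
    simp only [mem_setOf_eq, mem_union, true_and]
    constructor
    · intro hcut
      by_cases hts : t ∈ clusOff {a} ω s
      · right
        rcases hv with rfl | rfl
        · exact ⟨hcut, hts⟩
        · exact ⟨(cut_iff_of_mem_block hsa hta hts).1 hcut, hts⟩
      · exact Or.inl ⟨hcut, hts⟩
    · rintro (⟨hcut, -⟩ | ⟨hcut, hts⟩)
      · exact hcut
      · rcases hv with rfl | rfl
        · exact hcut
        · exact (cut_iff_of_mem_block hsa hta hts).2 hcut
  have hF0 : ∫ ω in D, F (openEdgeCluster ω s) ∂(prodBernoulli w₀) ≤ 0 := by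
    rw [eF]; linarith [hsplit s (Or.inl rfl), hsplit t (Or.inr rfl)]
  have hG0 : 0 ≤ ∫ ω in D, G (openEdgeCluster ω s) ∂(prodBernoulli w₀) :=
    setIntegral_nonneg MeasurableSet.of_discrete fun ω _ => ind_nonneg _ _
  have hprod : (prodBernoulli w₀).real D * ∫ ω in D, F (openEdgeCluster ω s) * G (openEdgeCluster ω s) ∂(prodBernoulli w₀) ≤ 0 :=
    key.trans (mul_nonpos_of_nonpos_of_nonneg hF0 hG0)
  -- conclude
  by_cases hD0 : (prodBernoulli w₀).real D = 0
  · have : ∫ ω in D, F (openEdgeCluster ω s) * G (openEdgeCluster ω s) ∂(prodBernoulli w₀) = 0 :=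
      setIntegral_measure_zero _ ((measureReal_eq_zero_iff (measure_ne_top _ _)).1 hD0)
    rw [eFG] at this; linarith
  · have hDpos : 0 < (prodBernoulli w₀).real D := lt_of_le_of_ne measureReal_nonneg (Ne.symm hD0)
    have : ∫ ω in D, F (openEdgeCluster ω s) * G (openEdgeCluster ω s) ∂(prodBernoulli w₀) ≤ 0 := by
      by_contra hc
      push Not at hc
      linarith [mul_pos hDpos hc]
    rw [eFG] at this; linarith

/-- **THE BUDGET INEQUALITY, UP-SET FORM** (CANDIDATES §GEN-17 R147, the «second vdBHK family»: up-sets of the OTHER relay's block).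
Hub `a`, relays `s ≠ t` (both `≠ a`) with `μ(t ↮ a) ≤ μ(s ↮ a)`, and an UP-closed test `U` of the block `B_t = clusOff {a} ω t` of the
SMALLER relay:  `μ(t ↮ a ∧ U(B_t) ∧ s ∉ B_t) ≤ μ(s ↮ a ∧ U(B_t) ∧ s ∉ B_t)`.  Instances: `U = «contains v_y»` (row `Cpair_ty`),
`U = «contains both others»` (`Ctriple`), `U = «contains another relay»` (`Cnotalone_t`), the `O_up` rows.  Proof: the identification
`setIntegral_indF_eq` with the roles of `s, t` exchanged (cluster of `t`, `F = ρ_s − q` increasing, `G = 1_U` increasing) and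
van den Berg–Häggström–Kahn Thm 1.3 in its increasing/increasing form; `E[F; t ↮ s] = μ(s ↮ a) − μ(t ↮ a) ≥ 0`.
[cite: VandenbergHaggstromKahn2005, Thm. 1.3 (p. 6)] -/
theorem budget_row_up (w : Sym2 (Fin n) → unitInterval) (a s t : Fin n) (hsa : s ≠ a) (hta : t ≠ a) (hst : s ≠ t)
    (U : Finset (Fin n) → Prop) (hU : ∀ S S' : Finset (Fin n), S ⊆ S' → U S → U S')
    (hδ : (prodBernoulli w).real {ω : BondConfig (Fin n) | ¬ (openGraph ω).Reachable a t} ≤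
      (prodBernoulli w).real {ω : BondConfig (Fin n) | ¬ (openGraph ω).Reachable a s}) :
    (prodBernoulli w).real {ω : BondConfig (Fin n) | ¬ (openGraph ω).Reachable a t ∧
        (U (clusOff {a} ω t) ∧ s ∉ clusOff {a} ω t)} ≤
      (prodBernoulli w).real {ω : BondConfig (Fin n) | ¬ (openGraph ω).Reachable a s ∧
        (U (clusOff {a} ω t) ∧ s ∉ clusOff {a} ω t)} := by
  set μ := prodBernoulli w with hμ
  set A : Set (Sym2 (Fin n)) := ↑(pairsAt {a}) with hA
  set w₀ : Sym2 (Fin n) → unitInterval := fun e => if e ∈ A then 0 else w e with hw₀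
  have h0 : ∀ e ∈ A, w₀ e = 0 := fun e he => by simp only [hw₀, if_pos he]
  have h1 : ∀ e ∉ A, w₀ e = w e := fun e he => by simp only [hw₀, if_neg he]
  have hw00 : ∀ e, 0 ≤ (fun e => (w₀ e : ℝ)) e := fun e => (w₀ e).2.1
  have hw01 : ∀ e, (fun e => (w₀ e : ℝ)) e ≤ 1 := fun e => (w₀ e).2.2
  set q : Finset (Fin n) → ℝ := fun S => 1 - attachProb w {a} S with hq
  have hqa : Antitone q := hubWt_antitone w a
  -- cluster of `t`; `F = ρ_s − q`, `G = 1_U`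
  set F : Set (Sym2 (Fin n)) → ℝ := fun W => (∑ η, weight (fun e => (w₀ e : ℝ)) η *
      q (vx s (openEdgeCluster (η \ {e | ∃ v ∈ e, v = t ∨ ∃ e' ∈ W, v ∈ e'}) s))) - q (vx t W) with hFdef
  set G : Set (Sym2 (Fin n)) → ℝ := fun W => ind {W : Set (Sym2 (Fin n)) | U (vx t W)} W with hGdef
  have hFm : Monotone F := by
    have h1m : Monotone fun W : Set (Sym2 (Fin n)) => ∑ η, weight (fun e => (w₀ e : ℝ)) η *
        q (vx s (openEdgeCluster (η \ {e | ∃ v ∈ e, v = t ∨ ∃ e' ∈ W, v ∈ e'}) s)) :=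
      condAvg_mono hw00 hw01 s (bar_mono t) (H := fun (_ : Set (Sym2 (Fin n))) C => q (vx s C))
        (fun _ => fun _ _ _ => le_rfl) (fun _ => fun C C' hCC' => hqa (vx_mono s hCC'))
    intro W W' hWW'
    have := h1m hWW'
    have h2 : q (vx t W') ≤ q (vx t W) := hqa (vx_mono t hWW')
    simp only [hFdef]
    linarith
  have hGm : Monotone G := by
    intro W W' hWW'
    simp only [hGdef]
    by_cases hW : W ∈ {W : Set (Sym2 (Fin n)) | U (vx t W)}
    · rw [ind_of_mem hW, ind_of_mem (show W' ∈ {W : Set (Sym2 (Fin n)) | U (vx t W)} from hU _ _ (vx_mono t hWW') hW)]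
    · rw [ind_of_not_mem hW]; exact ind_nonneg _ _
  have htX : t ∉ ({s} : Set (Fin n)) := by simpa using (Ne.symm hst)
  have key := BHK2006_clusterConditionalPositiveAssociation_holds (Fin n) w₀ t ({s} : Set (Fin n)) F G hFm hGm htX
  set D : Set (BondConfig (Fin n)) := {ω | ∀ x ∈ ({s} : Set (Fin n)), ¬ (openGraph ω).Reachable t x} with hD
  -- the integrals (roles of `s, t` exchanged in `setIntegral_indF_eq`)
  have eFG : ∫ ω in D, F (openEdgeCluster ω t) * G (openEdgeCluster ω t) ∂(prodBernoulli w₀) =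
      μ.real {ω | ¬ (openGraph ω).Reachable a s ∧ (U (clusOff {a} ω t) ∧ s ∉ clusOff {a} ω t)} -
        μ.real {ω | ¬ (openGraph ω).Reachable a t ∧ (U (clusOff {a} ω t) ∧ s ∉ clusOff {a} ω t)} := by
    rw [← setIntegral_indF_eq w w₀ a t s hta hsa h0 h1 F (fun W => rfl) U]
    exact integral_congr_ae (Filter.Eventually.of_forall fun ω => mul_comm _ _)
  have eF : ∫ ω in D, F (openEdgeCluster ω t) ∂(prodBernoulli w₀) =
      μ.real {ω | ¬ (openGraph ω).Reachable a s ∧ (True ∧ s ∉ clusOff {a} ω t)} -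
        μ.real {ω | ¬ (openGraph ω).Reachable a t ∧ (True ∧ s ∉ clusOff {a} ω t)} := by
    rw [← setIntegral_indF_eq w w₀ a t s hta hsa h0 h1 F (fun W => rfl) (fun _ => True)]
    refine integral_congr_ae (Filter.Eventually.of_forall fun ω => ?_)
    show F (openEdgeCluster ω t) = ind {W : Set (Sym2 (Fin n)) | True} (openEdgeCluster ω t) * F (openEdgeCluster ω t)
    rw [ind_of_mem (show openEdgeCluster ω t ∈ {W : Set (Sym2 (Fin n)) | True} from trivial), one_mul]
  have hsplit : ∀ v : Fin n, (v = t ∨ v = s) → μ.real {ω | ¬ (openGraph ω).Reachable a v} =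
      μ.real {ω | ¬ (openGraph ω).Reachable a v ∧ (True ∧ s ∉ clusOff {a} ω t)} +
        μ.real {ω | ¬ (openGraph ω).Reachable a t ∧ s ∈ clusOff {a} ω t} := by
    intro v hv
    rw [← measureReal_union (Set.disjoint_left.2 fun ω h1' h2' => h1'.2.2 h2'.2) MeasurableSet.of_discrete]
    congr 1
    ext ω
    simp only [mem_setOf_eq, mem_union, true_and]
    constructor
    · intro hcut
      by_cases hts : s ∈ clusOff {a} ω t
      · right
        rcases hv with rfl | rfl
        · exact ⟨hcut, hts⟩
        · exact ⟨(cut_iff_of_mem_block hta hsa hts).1 hcut, hts⟩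
      · exact Or.inl ⟨hcut, hts⟩
    · rintro (⟨hcut, -⟩ | ⟨hcut, hts⟩)
      · exact hcut
      · rcases hv with rfl | rfl
        · exact hcut
        · exact (cut_iff_of_mem_block hta hsa hts).2 hcut
  have hF0 : 0 ≤ ∫ ω in D, F (openEdgeCluster ω t) ∂(prodBernoulli w₀) := by
    rw [eF]; linarith [hsplit t (Or.inl rfl), hsplit s (Or.inr rfl)]
  have hG0 : 0 ≤ ∫ ω in D, G (openEdgeCluster ω t) ∂(prodBernoulli w₀) :=
    setIntegral_nonneg MeasurableSet.of_discrete fun ω _ => ind_nonneg _ _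
  have hprod : 0 ≤ (prodBernoulli w₀).real D * ∫ ω in D, F (openEdgeCluster ω t) * G (openEdgeCluster ω t) ∂(prodBernoulli w₀) :=
    (mul_nonneg hF0 hG0).trans key
  by_cases hD0 : (prodBernoulli w₀).real D = 0
  · have : ∫ ω in D, F (openEdgeCluster ω t) * G (openEdgeCluster ω t) ∂(prodBernoulli w₀) = 0 :=
      setIntegral_measure_zero _ ((measureReal_eq_zero_iff (measure_ne_top _ _)).1 hD0)
    rw [eFG] at this; linarith
  · have hDpos : 0 < (prodBernoulli w₀).real D := lt_of_le_of_ne measureReal_nonneg (Ne.symm hD0)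
    have : 0 ≤ ∫ ω in D, F (openEdgeCluster ω t) * G (openEdgeCluster ω t) ∂(prodBernoulli w₀) := by
      by_contra hc
      push Not at hc
      linarith [mul_pos_of_neg_of_neg (neg_neg_of_pos hDpos) hc, mul_neg_of_pos_of_neg hDpos hc]
    rw [eFG] at this; linarith

end Budget
end Refresh
end HubOnly
end Summit.CriticalPhenomena.PercolationContinuityZ3.Theorems
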